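import Mathlib
import HarnessLib

/-!
# The Green operator of `y'' − γ₀² y` on a half-line in exponentially weighted sup norm

Topic `Literature/Analysis/ODE` (namespace `Literature.Analysis.ODE`). Infrastructure for the
construction of exponentially DECAYING ("Jost", "subordinate") solutions of
`y'' = (γ₀² + w(r)) y` on `[R₁, ∞)` (`Re γ₀ > 0`, `w` bounded continuous and small — long-range
`1/r` tails allowed, only `sup |w|` matters), with holomorphic dependence on parameters, as used
for the radial Klein–Gordon equation on Kerr at spatial infinity (Shlapentokh-Rothman, CMP 329
(2014), §2 (2.4)–(2.5), Lemma 4.5; Hartman Ch. XI §9 / Ch. X §17 for asymptotic integration).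

The decaying solution is sought as `y(r) = e^{−γ₁(r−R₁)} z(r)` with `0 ≤ γ₁ < Re γ₀` (`γ₁ = 0` is
allowed throughout; `γ₁ > 0` is what gives exponential decay downstream) and `z` in
the Banach algebra `X = ℝ →ᵇ ℂ`, solving `z = z₀ + K(w·z)` where `K` is the weighted Green
operator
`(Kφ)(r) = −(1/2γ₀) [ e^{−a(r−R₁)} ∫_{R₁}^{r} e^{a(s−R₁)} φ(s) ds + e^{b(r−R₁)} ∫_{r}^{∞} e^{−b(s−R₁)} φ(s) ds ]`
(`a = γ₀ − γ₁`, `b = γ₀ + γ₁`, `r ≥ R₁`; frozen at `r = R₁` below `R₁`). This file provides: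

* `nfix T e = (1 − T)⁻¹ e`, the Neumann fixed point on a Banach space, with the fixed-point
  equation, uniqueness, a priori bound and smooth dependence on parameters (generalising
  `RecursiveSeries.affineFix`);
* `BCF.mk`, and abbreviations `BCF.ev r` (Mathlib's `evalCLM`), `BCF.mulOp w` (Mathlib's
  `ContinuousLinearMap.mul`);
* the primitive functionals `jostJ₁ a R₁ φ r = ∫_{R₁}^{r} e^{a(s−R₁)} φ`,
  `jostJ₂ b R₁ φ r = ∫_{r}^{∞} e^{−b(s−R₁)} φ` with their bounds, continuity and derivatives;
* the Green operator `jostK γ₀ γ₁ R₁ : X →L[ℂ] X` with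
  `‖jostK‖ ≤ (1/(2‖γ₀‖)) (1/Re a + 1/Re b)` (`norm_jostK_le`).

Everything is proved.

## References

* P. Hartman, *Ordinary Differential Equations*, SIAM Classics 38 (2002), Ch. X §17, Ch. XI §9.
  Key `Hartman2002`.
* Y. Shlapentokh-Rothman, Comm. Math. Phys. 329 (2014) 859–891, §2 (2.4)–(2.5), Lemma 4.5.
  Key `ShlapentokhRothman2014KleinGordon`.
-/

noncomputable section

open Set Filter Metric MeasureTheory intervalIntegral
open scoped Topology ContDiff

namespace Literature.Analysis.ODE

/-! ### The Neumann fixed point on a Banach space -/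

section Neumann

variable {𝕜 : Type*} [NontriviallyNormedField 𝕜] {E : Type*} [NormedAddCommGroup E] [NormedSpace 𝕜 E]
  [CompleteSpace E]

/-- The solution `(1 − T)⁻¹ e` of `x = e + T x` (for `‖T‖ < 1`). [folklore] -/
def nfix (T : E →L[𝕜] E) (e : E) : E := Ring.inverse (1 - T) e

variable {T : E →L[𝕜] E}

/-- `Ring.inverse (1 − T)` is the inverse of the unit `1 − T`. [folklore] -/
theorem ringInverse_one_sub_eq' (hT : ‖T‖ < 1) :
    Ring.inverse (1 - T) = ((Units.oneSub T hT)⁻¹ : (E →L[𝕜] E)ˣ) := by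
  rw [← Units.val_oneSub T hT, Ring.inverse_unit]

/-- `(1 − T)(nfix T e) = e`. [folklore] -/
theorem one_sub_apply_nfix (hT : ‖T‖ < 1) (e : E) : (1 - T) (nfix T e) = e := by
  have hmul : (1 - T) * Ring.inverse (1 - T) = 1 := by
    rw [ringInverse_one_sub_eq' hT, ← Units.val_oneSub T hT]
    exact (Units.oneSub T hT).mul_inv
  exact congrArg (fun A : E →L[𝕜] E ↦ A e) hmul

/-- **The fixed-point equation** `nfix T e = e + T (nfix T e)`. [folklore] -/
theorem nfix_eq (hT : ‖T‖ < 1) (e : E) : nfix T e = e + T (nfix T e) := by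
  have h := one_sub_apply_nfix hT e
  rw [show (1 - T) (nfix T e) = nfix T e - T (nfix T e) from rfl] at h
  rw [← sub_eq_iff_eq_add]
  exact h

/-- **Uniqueness** of solutions of `x = e + T x`. [folklore] -/
theorem eq_nfix (hT : ‖T‖ < 1) {x e : E} (hx : x = e + T x) : x = nfix T e := by
  have h1 : (1 - T) x = e := by
    rw [show (1 - T) x = x - T x from rfl]
    exact sub_eq_of_eq_add hx
  have h2 : (1 - T) (nfix T e) = e := one_sub_apply_nfix hT e
  have hinj : Function.Injective (1 - T : E →L[𝕜] E) := by
    rw [← Units.val_oneSub T hT]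
    exact (ContinuousLinearMap.isUnit_iff_bijective.1 (Units.isUnit _)).1
  exact hinj (h1.trans h2.symm)

/-- **A priori bound** `‖nfix T e‖ ≤ ‖e‖/(1 − ‖T‖)`. [folklore] -/
theorem norm_nfix_le (hT : ‖T‖ < 1) (e : E) : ‖nfix T e‖ ≤ ‖e‖ / (1 - ‖T‖) := by
  have h1 : ‖nfix T e‖ ≤ ‖e‖ + ‖T‖ * ‖nfix T e‖ :=
    calc ‖nfix T e‖ = ‖e + T (nfix T e)‖ := congrArg norm (nfix_eq hT e)
      _ ≤ ‖e‖ + ‖T (nfix T e)‖ := norm_add_le _ _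
      _ ≤ ‖e‖ + ‖T‖ * ‖nfix T e‖ := by gcongr; exact T.le_opNorm _
  have ht : 0 < 1 - ‖T‖ := sub_pos.2 hT
  rw [le_div_iff₀ ht]
  nlinarith [norm_nonneg (nfix T e), h1]

omit [CompleteSpace E] in
/-- `nfix` is linear in `e`. [folklore] -/
theorem nfix_add (T : E →L[𝕜] E) (e₁ e₂ : E) : nfix T (e₁ + e₂) = nfix T e₁ + nfix T e₂ := map_add _ _ _

omit [CompleteSpace E] in
/-- `nfix` is linear in `e`. [folklore] -/
theorem nfix_smul (T : E →L[𝕜] E) (c : 𝕜) (e : E) : nfix T (c • e) = c • nfix T e := map_smul _ _ _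

/-- **Smoothness of the fixed point in parameters** (inversion is smooth at units of the Banach
algebra `E →L E`, application is bounded bilinear). [folklore] -/
theorem contDiffAt_nfix {P : Type*} [NormedAddCommGroup P] [NormedSpace 𝕜 P]
    {Tf : P → E →L[𝕜] E} {ef : P → E} {p₀ : P} {n : WithTop ℕ∞}
    (hT : ContDiffAt 𝕜 n Tf p₀) (he : ContDiffAt 𝕜 n ef p₀) (h1 : ‖Tf p₀‖ < 1) :
    ContDiffAt 𝕜 n (fun p ↦ nfix (Tf p) (ef p)) p₀ := by
  have hinv : ContDiffAt 𝕜 n (Ring.inverse : (E →L[𝕜] E) → E →L[𝕜] E) (1 - Tf p₀) := by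
    have h := contDiffAt_ringInverse 𝕜 (n := n) (Units.oneSub (Tf p₀) h1)
    rwa [Units.val_oneSub] at h
  have hsub : ContDiffAt 𝕜 n (fun p ↦ (1 : E →L[𝕜] E) - Tf p) p₀ := contDiffAt_const.sub hT
  have hcomp : ContDiffAt 𝕜 n (fun p ↦ Ring.inverse ((1 : E →L[𝕜] E) - Tf p)) p₀ :=
    ContDiffAt.comp (g := Ring.inverse) p₀ hinv hsub
  have happ : ContDiff 𝕜 n fun q : (E →L[𝕜] E) × E ↦ q.1 q.2 := isBoundedBilinearMap_apply.contDiff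
  exact happ.comp_contDiffAt p₀ (hcomp.prodMk he)

/-- The same over an open set. [folklore] -/
theorem contDiffOn_nfix {P : Type*} [NormedAddCommGroup P] [NormedSpace 𝕜 P]
    {Tf : P → E →L[𝕜] E} {ef : P → E} {U : Set P} {n : WithTop ℕ∞} (hU : IsOpen U)
    (hT : ContDiffOn 𝕜 n Tf U) (he : ContDiffOn 𝕜 n ef U) (h1 : ∀ p ∈ U, ‖Tf p‖ < 1) :
    ContDiffOn 𝕜 n (fun p ↦ nfix (Tf p) (ef p)) U := fun p hp ↦
  (contDiffAt_nfix (hT.contDiffAt (hU.mem_nhds hp)) (he.contDiffAt (hU.mem_nhds hp)) (h1 p hp)).contDiffWithinAt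

end Neumann

/-! ### The Banach algebra `X = ℝ →ᵇ ℂ` -/

/-- The space of bounded continuous complex functions on the line. [folklore] -/
abbrev BCF : Type := BoundedContinuousFunction ℝ ℂ

namespace BCF

/-- A bounded continuous function from a continuous function and a bound. [folklore] -/
def mk (f : ℝ → ℂ) (hf : Continuous f) (C : ℝ) (hC : ∀ r, ‖f r‖ ≤ C) : BCF :=
  BoundedContinuousFunction.ofNormedAddCommGroup f hf C hC

/-- Values of `mk`. [folklore] -/
@[simp] theorem mk_apply (f : ℝ → ℂ) (hf : Continuous f) (C : ℝ) (hC : ∀ r, ‖f r‖ ≤ C) (r : ℝ) :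
    mk f hf C hC r = f r := rfl

/-- `‖mk f _ C _‖ ≤ C` for `0 ≤ C`. [folklore] -/
theorem norm_mk_le {f : ℝ → ℂ} {hf : Continuous f} {C : ℝ} (hC0 : 0 ≤ C) (hC : ∀ r, ‖f r‖ ≤ C) :
    ‖mk f hf C hC‖ ≤ C :=
  BoundedContinuousFunction.norm_ofNormedAddCommGroup_le hf hC0 hC

/-- `‖φ r‖ ≤ ‖φ‖`. [folklore] -/
theorem norm_apply_le (φ : BCF) (r : ℝ) : ‖φ r‖ ≤ ‖φ‖ := BoundedContinuousFunction.norm_coe_le_norm φ r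

/-- Evaluation at `r` as a continuous linear functional: Mathlib's
`BoundedContinuousFunction.evalCLM ℂ r` (kept as an abbreviation for readability). [folklore] -/
abbrev ev (r : ℝ) : BCF →L[ℂ] ℂ := BoundedContinuousFunction.evalCLM ℂ r

/-- `ev r φ = φ r`. [folklore] -/
@[simp] theorem ev_apply (r : ℝ) (φ : BCF) : ev r φ = φ r := rfl

/-- Multiplication by `w ∈ X`: Mathlib's left multiplication `ContinuousLinearMap.mul ℂ BCF w` in the
Banach algebra `X` (an abbreviation), a continuous linear map of norm `≤ ‖w‖`. [folklore] -/
abbrev mulOp (w : BCF) : BCF →L[ℂ] BCF := ContinuousLinearMap.mul ℂ BCF w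

/-- `(mulOp w φ)(r) = w r · φ r`. [folklore] -/
@[simp] theorem mulOp_apply (w φ : BCF) (r : ℝ) : mulOp w φ r = w r * φ r := rfl

/-- `‖mulOp w‖ ≤ ‖w‖`. [folklore] -/
theorem norm_mulOp_le (w : BCF) : ‖mulOp w‖ ≤ ‖w‖ :=
  ContinuousLinearMap.opNorm_le_bound _ (norm_nonneg w) fun φ ↦ norm_mul_le w φ

/-- `w ↦ mulOp w` is a continuous linear (hence smooth) map. [folklore] -/
theorem contDiff_mulOp {n : WithTop ℕ∞} : ContDiff ℂ n fun w : BCF ↦ mulOp w :=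
  (ContinuousLinearMap.mul ℂ BCF).contDiff

end BCF

/-! ### The primitive functionals `J₁`, `J₂` -/

section Primitives

/-- The weighted integrand `s ↦ e^{c(s−R₁)} φ(s)` is continuous. [folklore] -/
theorem continuous_expWeight_mul (c : ℂ) (R₁ : ℝ) (φ : BCF) :
    Continuous fun s : ℝ ↦ Complex.exp (c * ((s - R₁ : ℝ) : ℂ)) * φ s := by
  have h1 : Continuous fun s : ℝ ↦ Complex.exp (c * ((s - R₁ : ℝ) : ℂ)) := by fun_prop
  exact h1.mul φ.continuous

/-- Norm of the weight: `‖e^{c(s−R₁)}‖ = e^{Re c (s−R₁)}`. [folklore] -/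
theorem norm_expWeight (c : ℂ) (R₁ s : ℝ) : ‖Complex.exp (c * ((s - R₁ : ℝ) : ℂ))‖ = Real.exp (c.re * (s - R₁)) := by
  rw [Complex.norm_exp, Complex.mul_re, Complex.ofReal_re, Complex.ofReal_im, mul_zero, sub_zero]

/-- **`J₁(φ)(r) = ∫_{R₁}^{r} e^{a(s−R₁)} φ(s) ds`.** [folklore] -/
def jostJ₁ (a : ℂ) (R₁ : ℝ) (φ : BCF) (r : ℝ) : ℂ := ∫ s in R₁..r, Complex.exp (a * ((s - R₁ : ℝ) : ℂ)) * φ s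

/-- `J₁` is continuous in `r`. [folklore] -/
theorem continuous_jostJ₁ (a : ℂ) (R₁ : ℝ) (φ : BCF) : Continuous (jostJ₁ a R₁ φ) :=
  continuous_primitive (fun x y ↦ (continuous_expWeight_mul a R₁ φ).intervalIntegrable x y) R₁

/-- `J₁(φ)(R₁) = 0`. [folklore] -/
@[simp] theorem jostJ₁_self (a : ℂ) (R₁ : ℝ) (φ : BCF) : jostJ₁ a R₁ φ R₁ = 0 := integral_same

/-- **FTC for `J₁`**: `d/dr J₁(φ)(r) = e^{a(r−R₁)} φ(r)`. [folklore] -/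
theorem hasDerivAt_jostJ₁ (a : ℂ) (R₁ : ℝ) (φ : BCF) (r : ℝ) :
    HasDerivAt (jostJ₁ a R₁ φ) (Complex.exp (a * ((r - R₁ : ℝ) : ℂ)) * φ r) r :=
  integral_hasDerivAt_right ((continuous_expWeight_mul a R₁ φ).intervalIntegrable _ _)
    ((continuous_expWeight_mul a R₁ φ).stronglyMeasurableAtFilter _ _)
    (continuous_expWeight_mul a R₁ φ).continuousAt

/-- **Bound for `J₁`**: for `Re a > 0` and `r ≥ R₁`,
`‖e^{−a(r−R₁)} J₁(φ)(r)‖ ≤ ‖φ‖/Re a`. [folklore] -/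
theorem norm_exp_mul_jostJ₁_le {a : ℂ} (ha : 0 < a.re) (R₁ : ℝ) (φ : BCF) {r : ℝ} (hr : R₁ ≤ r) :
    ‖Complex.exp (-(a * ((r - R₁ : ℝ) : ℂ))) * jostJ₁ a R₁ φ r‖ ≤ ‖φ‖ / a.re := by
  have hbound : ‖jostJ₁ a R₁ φ r‖ ≤ ∫ s in R₁..r, Real.exp (a.re * (s - R₁)) * ‖φ‖ := by
    refine intervalIntegral.norm_integral_le_of_norm_le hr (Eventually.of_forall fun s _ ↦ ?_) ?_
    · rw [norm_mul, norm_expWeight]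
      exact mul_le_mul_of_nonneg_left (BCF.norm_apply_le φ s) (Real.exp_pos _).le
    · exact (by fun_prop : Continuous fun s : ℝ ↦ Real.exp (a.re * (s - R₁)) * ‖φ‖).intervalIntegrable _ _
  have hint : ∫ s in R₁..r, Real.exp (a.re * (s - R₁)) * ‖φ‖ = (Real.exp (a.re * (r - R₁)) - 1) / a.re * ‖φ‖ := by
    rw [intervalIntegral.integral_mul_const]
    congr 1
    have hderiv : ∀ s ∈ uIcc R₁ r, HasDerivAt (fun s ↦ Real.exp (a.re * (s - R₁)) / a.re) (Real.exp (a.re * (s - R₁))) s := by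
      intro s _
      have h := ((((hasDerivAt_id' s).sub_const R₁).const_mul a.re).exp).div_const a.re
      refine h.congr_deriv ?_
      field_simp
    rw [integral_eq_sub_of_hasDerivAt hderiv ((by fun_prop : Continuous fun s : ℝ ↦ Real.exp (a.re * (s - R₁))).intervalIntegrable _ _)]
    simp
    ring
  rw [norm_mul, Complex.norm_exp]
  have hre : (-(a * ((r - R₁ : ℝ) : ℂ))).re = -(a.re * (r - R₁)) := by
    simp [Complex.mul_re]
  rw [hre]
  calc Real.exp (-(a.re * (r - R₁))) * ‖jostJ₁ a R₁ φ r‖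
      ≤ Real.exp (-(a.re * (r - R₁))) * ((Real.exp (a.re * (r - R₁)) - 1) / a.re * ‖φ‖) := by
        gcongr; exact hbound.trans (le_of_eq hint)
    _ = (1 - Real.exp (-(a.re * (r - R₁)))) / a.re * ‖φ‖ := by
        rw [Real.exp_neg]
        field_simp
    _ ≤ 1 / a.re * ‖φ‖ := by
        gcongr
        · linarith [Real.exp_pos (-(a.re * (r - R₁)))]
    _ = ‖φ‖ / a.re := by ring

/-- The tail integrand `e^{−b(s−R₁)} φ(s)` is integrable on `(c, ∞)` for `Re b > 0`. [folklore] -/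
theorem integrableOn_expWeight_mul {b : ℂ} (hb : 0 < b.re) (R₁ : ℝ) (φ : BCF) (c : ℝ) :
    IntegrableOn (fun s : ℝ ↦ Complex.exp (-(b * ((s - R₁ : ℝ) : ℂ))) * φ s) (Ioi c) := by
  have h1 : IntegrableOn (fun s : ℝ ↦ Complex.exp (-(b * ((s - R₁ : ℝ) : ℂ)))) (Ioi c) := by
    have h : IntegrableOn (fun s : ℝ ↦ Complex.exp (-b * (s : ℂ)) * Complex.exp (b * R₁)) (Ioi c) :=
      (integrableOn_exp_mul_complex_Ioi (a := -b) (by simpa using hb) c).mul_const (Complex.exp (b * R₁))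
    refine h.congr_fun (fun s _ ↦ ?_) measurableSet_Ioi
    show Complex.exp (-b * (s : ℂ)) * Complex.exp (b * R₁) = _
    rw [← Complex.exp_add]
    congr 1
    push_cast
    ring
  exact h1.mul_bdd φ.continuous.aestronglyMeasurable (Eventually.of_forall fun s ↦ BCF.norm_apply_le φ s)

/-- **`J₂(φ)(r) = ∫_{r}^{∞} e^{−b(s−R₁)} φ(s) ds`.** [folklore] -/
def jostJ₂ (b : ℂ) (R₁ : ℝ) (φ : BCF) (r : ℝ) : ℂ := ∫ s in Ioi r, Complex.exp (-(b * ((s - R₁ : ℝ) : ℂ))) * φ s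

/-- `J₂(r) = J₂(R₁) − ∫_{R₁}^{r} (integrable tail)`. [folklore] -/
theorem jostJ₂_eq_sub {b : ℂ} (hb : 0 < b.re) (R₁ : ℝ) (φ : BCF) (r : ℝ) :
    jostJ₂ b R₁ φ r = jostJ₂ b R₁ φ R₁ - ∫ s in R₁..r, Complex.exp (-(b * ((s - R₁ : ℝ) : ℂ))) * φ s := by
  have h := integral_interval_add_Ioi (integrableOn_expWeight_mul hb R₁ φ R₁) (integrableOn_expWeight_mul hb R₁ φ r)
  rw [jostJ₂, jostJ₂, ← h]
  ring

/-- `J₂` is continuous in `r`. [folklore] -/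
theorem continuous_jostJ₂ {b : ℂ} (hb : 0 < b.re) (R₁ : ℝ) (φ : BCF) : Continuous (jostJ₂ b R₁ φ) := by
  have hc : Continuous fun s : ℝ ↦ Complex.exp (-(b * ((s - R₁ : ℝ) : ℂ))) * φ s := by
    have h1 : Continuous fun s : ℝ ↦ Complex.exp (-(b * ((s - R₁ : ℝ) : ℂ))) := by fun_prop
    exact h1.mul φ.continuous
  have h : jostJ₂ b R₁ φ = fun r ↦ jostJ₂ b R₁ φ R₁ - ∫ s in R₁..r, Complex.exp (-(b * ((s - R₁ : ℝ) : ℂ))) * φ s :=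
    funext (jostJ₂_eq_sub hb R₁ φ)
  rw [h]
  exact continuous_const.sub (continuous_primitive (fun x y ↦ hc.intervalIntegrable x y) R₁)

/-- **FTC for `J₂`**: `d/dr J₂(φ)(r) = −e^{−b(r−R₁)} φ(r)`. [folklore] -/
theorem hasDerivAt_jostJ₂ {b : ℂ} (hb : 0 < b.re) (R₁ : ℝ) (φ : BCF) (r : ℝ) :
    HasDerivAt (jostJ₂ b R₁ φ) (-(Complex.exp (-(b * ((r - R₁ : ℝ) : ℂ))) * φ r)) r := by
  have hc : Continuous fun s : ℝ ↦ Complex.exp (-(b * ((s - R₁ : ℝ) : ℂ))) * φ s := by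
    have h1 : Continuous fun s : ℝ ↦ Complex.exp (-(b * ((s - R₁ : ℝ) : ℂ))) := by fun_prop
    exact h1.mul φ.continuous
  have h : jostJ₂ b R₁ φ = fun r ↦ jostJ₂ b R₁ φ R₁ - ∫ s in R₁..r, Complex.exp (-(b * ((s - R₁ : ℝ) : ℂ))) * φ s :=
    funext (jostJ₂_eq_sub hb R₁ φ)
  rw [h]
  exact (integral_hasDerivAt_right (hc.intervalIntegrable _ _) (hc.stronglyMeasurableAtFilter _ _) hc.continuousAt).const_sub _

/-- **Bound for `J₂`**: for `Re b > 0`, `‖e^{b(r−R₁)} J₂(φ)(r)‖ ≤ ‖φ‖/Re b`. [folklore] -/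
theorem norm_exp_mul_jostJ₂_le {b : ℂ} (hb : 0 < b.re) (R₁ : ℝ) (φ : BCF) (r : ℝ) :
    ‖Complex.exp (b * ((r - R₁ : ℝ) : ℂ)) * jostJ₂ b R₁ φ r‖ ≤ ‖φ‖ / b.re := by
  have hg : IntegrableOn (fun s : ℝ ↦ Real.exp (-(b.re * (s - R₁))) * ‖φ‖) (Ioi r) := by
    have h : IntegrableOn (fun s : ℝ ↦ Real.exp (-b.re * s) * (Real.exp (b.re * R₁) * ‖φ‖)) (Ioi r) :=
      (exp_neg_integrableOn_Ioi r hb).mul_const (Real.exp (b.re * R₁) * ‖φ‖)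
    refine h.congr_fun (fun s _ ↦ ?_) measurableSet_Ioi
    show Real.exp (-b.re * s) * (Real.exp (b.re * R₁) * ‖φ‖) = _
    rw [← mul_assoc, ← Real.exp_add]
    congr 1
    ring_nf
  have hbound : ‖jostJ₂ b R₁ φ r‖ ≤ ∫ s in Ioi r, Real.exp (-(b.re * (s - R₁))) * ‖φ‖ := by
    refine MeasureTheory.norm_integral_le_of_norm_le hg (Eventually.of_forall fun s ↦ ?_)
    rw [norm_mul, Complex.norm_exp]
    have hre : (-(b * ((s - R₁ : ℝ) : ℂ))).re = -(b.re * (s - R₁)) := by simp [Complex.mul_re]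
    rw [hre]
    exact mul_le_mul_of_nonneg_left (BCF.norm_apply_le φ s) (Real.exp_pos _).le
  have hint : ∫ s in Ioi r, Real.exp (-(b.re * (s - R₁))) * ‖φ‖ = Real.exp (-(b.re * (r - R₁))) / b.re * ‖φ‖ := by
    rw [MeasureTheory.integral_mul_const]
    congr 1
    have h := integral_exp_mul_Ioi (a := -b.re) (by linarith) r
    have hfun : (fun s : ℝ ↦ Real.exp (-(b.re * (s - R₁)))) = fun s : ℝ ↦ Real.exp (-b.re * s) * Real.exp (b.re * R₁) := by
      funext s; rw [← Real.exp_add]; ring_nf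
    rw [hfun, MeasureTheory.integral_mul_const, h]
    rw [show -(b.re * (r - R₁)) = -b.re * r + b.re * R₁ by ring, Real.exp_add]
    field_simp
  rw [norm_mul, Complex.norm_exp]
  have hre : (b * ((r - R₁ : ℝ) : ℂ)).re = b.re * (r - R₁) := by simp [Complex.mul_re]
  rw [hre]
  calc Real.exp (b.re * (r - R₁)) * ‖jostJ₂ b R₁ φ r‖
      ≤ Real.exp (b.re * (r - R₁)) * (Real.exp (-(b.re * (r - R₁))) / b.re * ‖φ‖) := by
        gcongr; exact hbound.trans (le_of_eq hint)
    _ = ‖φ‖ / b.re := by rw [Real.exp_neg]; field_simp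

/-- `J₁` is linear in `φ`: additivity. [folklore] -/
theorem jostJ₁_add (a : ℂ) (R₁ : ℝ) (φ ψ : BCF) (r : ℝ) : jostJ₁ a R₁ (φ + ψ) r = jostJ₁ a R₁ φ r + jostJ₁ a R₁ ψ r := by
  simp only [jostJ₁, BoundedContinuousFunction.coe_add, Pi.add_apply, mul_add]
  exact integral_add ((continuous_expWeight_mul a R₁ φ).intervalIntegrable _ _)
    ((continuous_expWeight_mul a R₁ ψ).intervalIntegrable _ _)

/-- `J₁` is linear in `φ`: homogeneity. [folklore] -/
theorem jostJ₁_smul (a : ℂ) (R₁ : ℝ) (c : ℂ) (φ : BCF) (r : ℝ) : jostJ₁ a R₁ (c • φ) r = c * jostJ₁ a R₁ φ r := by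
  simp only [jostJ₁, BoundedContinuousFunction.coe_smul, smul_eq_mul]
  rw [← intervalIntegral.integral_const_mul]
  congr 1; funext s; ring

/-- `J₂` is linear in `φ`: additivity. [folklore] -/
theorem jostJ₂_add {b : ℂ} (hb : 0 < b.re) (R₁ : ℝ) (φ ψ : BCF) (r : ℝ) :
    jostJ₂ b R₁ (φ + ψ) r = jostJ₂ b R₁ φ r + jostJ₂ b R₁ ψ r := by
  simp only [jostJ₂, BoundedContinuousFunction.coe_add, Pi.add_apply, mul_add]
  exact MeasureTheory.integral_add (integrableOn_expWeight_mul hb R₁ φ r) (integrableOn_expWeight_mul hb R₁ ψ r)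

/-- `J₂` is linear in `φ`: homogeneity. [folklore] -/
theorem jostJ₂_smul (b : ℂ) (R₁ : ℝ) (c : ℂ) (φ : BCF) (r : ℝ) : jostJ₂ b R₁ (c • φ) r = c * jostJ₂ b R₁ φ r := by
  simp only [jostJ₂, BoundedContinuousFunction.coe_smul, smul_eq_mul]
  rw [← MeasureTheory.integral_const_mul]
  congr 1; funext s; ring

end Primitives

/-! ### The Green operator -/

section Green

variable {γ₀ : ℂ} {γ₁ : ℝ}

/-- The raw Green function of a source `φ`, for all `r` (meaningful for `r ≥ R₁`):
`−(1/2γ₀)[e^{−a(r−R₁)} J₁(φ)(r) + e^{b(r−R₁)} J₂(φ)(r)]`, `a = γ₀ − γ₁`, `b = γ₀ + γ₁`. [folklore] -/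
def jostKraw (γ₀ : ℂ) (γ₁ R₁ : ℝ) (φ : BCF) (r : ℝ) : ℂ :=
  -(1 / (2 * γ₀)) *
    (Complex.exp (-((γ₀ - γ₁) * ((r - R₁ : ℝ) : ℂ))) * jostJ₁ (γ₀ - γ₁) R₁ φ r +
      Complex.exp ((γ₀ + γ₁) * ((r - R₁ : ℝ) : ℂ)) * jostJ₂ (γ₀ + γ₁) R₁ φ r)

/-- The Green function of `φ`, frozen below `R₁`: `r ↦ jostKraw φ (max r R₁)`. [folklore] -/
def jostKfun (γ₀ : ℂ) (γ₁ R₁ : ℝ) (φ : BCF) (r : ℝ) : ℂ := jostKraw γ₀ γ₁ R₁ φ (max r R₁)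

/-- The norm constant of the Green operator: `C_K = (1/(2‖γ₀‖))(1/Re a + 1/Re b)`. [folklore] -/
def jostKconst (γ₀ : ℂ) (γ₁ : ℝ) : ℝ := 1 / (2 * ‖γ₀‖) * (1 / (γ₀.re - γ₁) + 1 / (γ₀.re + γ₁))

/-- Pointwise bound for the raw Green function on `r ≥ R₁`. [folklore] -/
theorem norm_jostKraw_le (h₁ : 0 ≤ γ₁) (hγ : γ₁ < γ₀.re) (R₁ : ℝ) (φ : BCF) {r : ℝ} (hr : R₁ ≤ r) :
    ‖jostKraw γ₀ γ₁ R₁ φ r‖ ≤ jostKconst γ₀ γ₁ * ‖φ‖ := by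
  have ha : 0 < (γ₀ - γ₁).re := by simp; linarith
  have hb : 0 < (γ₀ + γ₁).re := by simp; linarith
  have hγ0 : γ₀ ≠ 0 := by
    intro h; rw [h] at hγ; simp at hγ; linarith
  have e1 := norm_exp_mul_jostJ₁_le ha R₁ φ hr
  have e2 := norm_exp_mul_jostJ₂_le hb R₁ φ r
  rw [jostKraw, norm_mul]
  have hc : ‖-(1 / (2 * γ₀))‖ = 1 / (2 * ‖γ₀‖) := by
    rw [norm_neg, norm_div, norm_mul, norm_one]; norm_num
  rw [hc, jostKconst]
  have hare : (γ₀ - (γ₁ : ℂ)).re = γ₀.re - γ₁ := by simp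
  have hbre : (γ₀ + (γ₁ : ℂ)).re = γ₀.re + γ₁ := by simp
  rw [hare] at e1
  rw [hbre] at e2
  calc 1 / (2 * ‖γ₀‖) * ‖Complex.exp (-((γ₀ - γ₁) * ((r - R₁ : ℝ) : ℂ))) * jostJ₁ (γ₀ - γ₁) R₁ φ r +
        Complex.exp ((γ₀ + γ₁) * ((r - R₁ : ℝ) : ℂ)) * jostJ₂ (γ₀ + γ₁) R₁ φ r‖
      ≤ 1 / (2 * ‖γ₀‖) * (‖φ‖ / (γ₀.re - γ₁) + ‖φ‖ / (γ₀.re + γ₁)) := by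
        gcongr
        exact (norm_add_le _ _).trans (add_le_add e1 e2)
    _ = 1 / (2 * ‖γ₀‖) * (1 / (γ₀.re - γ₁) + 1 / (γ₀.re + γ₁)) * ‖φ‖ := by ring

/-- The frozen Green function is continuous. [folklore] -/
theorem continuous_jostKfun (hγ : γ₁ < γ₀.re) (h₁ : 0 ≤ γ₁) (R₁ : ℝ) (φ : BCF) : Continuous (jostKfun γ₀ γ₁ R₁ φ) := by
  have hb : 0 < (γ₀ + γ₁).re := by simp; linarith
  have hraw : Continuous (jostKraw γ₀ γ₁ R₁ φ) := by
    unfold jostKraw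
    refine continuous_const.mul (Continuous.add ?_ ?_)
    · exact (by fun_prop : Continuous fun r : ℝ ↦ Complex.exp (-((γ₀ - γ₁) * ((r - R₁ : ℝ) : ℂ)))).mul
        (continuous_jostJ₁ _ _ _)
    · exact (by fun_prop : Continuous fun r : ℝ ↦ Complex.exp ((γ₀ + γ₁) * ((r - R₁ : ℝ) : ℂ))).mul
        (continuous_jostJ₂ hb _ _)
  exact hraw.comp (continuous_id.max continuous_const)

/-- The frozen Green function is bounded by `C_K ‖φ‖`. [folklore] -/
theorem norm_jostKfun_le (h₁ : 0 ≤ γ₁) (hγ : γ₁ < γ₀.re) (R₁ : ℝ) (φ : BCF) (r : ℝ) :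
    ‖jostKfun γ₀ γ₁ R₁ φ r‖ ≤ jostKconst γ₀ γ₁ * ‖φ‖ :=
  norm_jostKraw_le h₁ hγ R₁ φ (le_max_right _ _)

/-- `0 ≤ C_K`. [folklore] -/
theorem jostKconst_nonneg (h₁ : 0 ≤ γ₁) (hγ : γ₁ < γ₀.re) : 0 ≤ jostKconst γ₀ γ₁ := by
  unfold jostKconst
  have : 0 < γ₀.re - γ₁ := by linarith
  have : 0 < γ₀.re + γ₁ := by linarith
  positivity

/-- The Green function as an element of `X`. [folklore] -/
def jostKel (h₁ : 0 ≤ γ₁) (hγ : γ₁ < γ₀.re) (R₁ : ℝ) (φ : BCF) : BCF :=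
  BCF.mk (jostKfun γ₀ γ₁ R₁ φ) (continuous_jostKfun hγ h₁ R₁ φ) (jostKconst γ₀ γ₁ * ‖φ‖) (norm_jostKfun_le h₁ hγ R₁ φ)

/-- Values of `jostKel`. [folklore] -/
@[simp] theorem jostKel_apply (h₁ : 0 ≤ γ₁) (hγ : γ₁ < γ₀.re) (R₁ : ℝ) (φ : BCF) (r : ℝ) :
    jostKel h₁ hγ R₁ φ r = jostKraw γ₀ γ₁ R₁ φ (max r R₁) := rfl

/-- Additivity of the raw Green function in `φ`. [folklore] -/
theorem jostKraw_add (hγ : γ₁ < γ₀.re) (h₁ : 0 ≤ γ₁) (R₁ : ℝ) (φ ψ : BCF) (r : ℝ) :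
    jostKraw γ₀ γ₁ R₁ (φ + ψ) r = jostKraw γ₀ γ₁ R₁ φ r + jostKraw γ₀ γ₁ R₁ ψ r := by
  have hb : 0 < (γ₀ + γ₁).re := by simp; linarith
  simp only [jostKraw, jostJ₁_add, jostJ₂_add hb]
  ring

/-- Homogeneity of the raw Green function in `φ`. [folklore] -/
theorem jostKraw_smul (γ₀ : ℂ) (γ₁ R₁ : ℝ) (c : ℂ) (φ : BCF) (r : ℝ) :
    jostKraw γ₀ γ₁ R₁ (c • φ) r = c * jostKraw γ₀ γ₁ R₁ φ r := by
  simp only [jostKraw, jostJ₁_smul, jostJ₂_smul]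
  ring

/-- **The Green operator `K : X →L[ℂ] X`**, with `‖K‖ ≤ C_K = (1/(2‖γ₀‖))(1/(Re γ₀ − γ₁) + 1/(Re γ₀ + γ₁))`.
[cite: Hartman2002, Ch. X §17] -/
def jostK (h₁ : 0 ≤ γ₁) (hγ : γ₁ < γ₀.re) (R₁ : ℝ) : BCF →L[ℂ] BCF :=
  LinearMap.mkContinuous
    { toFun := jostKel h₁ hγ R₁
      map_add' := fun φ ψ ↦ by
        ext r
        simp [jostKraw_add hγ h₁]
      map_smul' := fun c φ ↦ by
        ext r
        simp [jostKraw_smul] }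
    (jostKconst γ₀ γ₁) fun φ ↦ by
      show ‖jostKel h₁ hγ R₁ φ‖ ≤ _
      exact BCF.norm_mk_le (mul_nonneg (jostKconst_nonneg h₁ hγ) (norm_nonneg φ)) (norm_jostKfun_le h₁ hγ R₁ φ)

/-- Values of the Green operator. [folklore] -/
@[simp] theorem jostK_apply (h₁ : 0 ≤ γ₁) (hγ : γ₁ < γ₀.re) (R₁ : ℝ) (φ : BCF) (r : ℝ) :
    jostK h₁ hγ R₁ φ r = jostKraw γ₀ γ₁ R₁ φ (max r R₁) := rfl

/-- Values of the Green operator on `r ≥ R₁`. [folklore] -/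
theorem jostK_apply_of_le (h₁ : 0 ≤ γ₁) (hγ : γ₁ < γ₀.re) {R₁ r : ℝ} (hr : R₁ ≤ r) (φ : BCF) :
    jostK h₁ hγ R₁ φ r = jostKraw γ₀ γ₁ R₁ φ r := by
  rw [jostK_apply, max_eq_left hr]

/-- **The norm bound** `‖K‖ ≤ C_K`. [cite: Hartman2002, Ch. X §17] -/
theorem norm_jostK_le (h₁ : 0 ≤ γ₁) (hγ : γ₁ < γ₀.re) (R₁ : ℝ) : ‖jostK h₁ hγ R₁‖ ≤ jostKconst γ₀ γ₁ :=
  LinearMap.mkContinuous_norm_le _ (jostKconst_nonneg h₁ hγ) _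

end Green

end Literature.Analysis.ODE

end
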